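import Summits.MatrixMultiplication.OmegaCensus.DihedralLikeFamily
import HarnessLib

/-!
# TPP triples containing a domino `{ρ0, τb}`: the packing conditions

ω-census, family (b3).  Framing: lottery ticket; floor = certified bounds/negative ranges.

Dihedral-like `G` over `A` (`ρaρb = ρ(a+b)`, `ρaτb = τ(b−a)`, `τaρb = τ(a+b)`, `τaτb = ρ(c₀+b−a)`); a TPP triple
`(S, T, U)` with `ρ0, τb ∈ S` (after right translation every law-attaining triple of cube shape `(1,1 | d,d | e,e)` has
`S = {ρ0, τb}`), coset parts `T₀ = {a : ρa ∈ T}`, `T₁ = {a : τa ∈ T}`, `U₀`, `U₁`.  Each statement below is ONE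
instance of the defining implication of the triple product property (with `s s'⁻¹ ∈ {1, τb, (τb)⁻¹}`), and together
they form the constraint system that the family-(b) census engines enumerate / SAT-encode (`cube1de.py`,
`cube1de2.py`; `FAMILY-B-ADDENDUM-g5.md` §3) — hence those searches are exhaustive over TPP triples:

* (i)   `domino_direct₀₀/₁₁/₀₁/₁₀`: the four sumsets `Tᵢ + Uⱼ` are direct (all sums distinct);
* (ii)  `domino_mixed_ne`: `t₁ − t₀ ∉ {u₁ − u₀, u₁ − u₀ + c₀}`;
* (iii) `domino_b_notin_T₀/T₁`, `domino_b_notin_U₀/U₁`: `b, b + c₀ ∉ (T₁ − T₀) + (Uⱼ − Uⱼ)` and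
        `b, b + c₀ ∉ (U₁ − U₀) + (Tᵢ − Tᵢ)` (here `c₀ + c₀ = 0`, `two_c0_eq_zero`).
-/

namespace Summit.MatrixMultiplication.OmegaCensus

open Literature.Combinatorics.Additive Finset

section DihedralLike

variable {A : Type*} [AddCommGroup A] {G : Type} [Group G]
  {ρ τ : A → G} {c₀ : A} {S T U : Finset G}

/-- (i) `T₀ + U₀` is direct. [folklore] -/
theorem domino_direct₀₀ (hρρ : ∀ a b, ρ a * ρ b = ρ (a + b)) (hρ : Function.Injective ρ)
    (h : TripleProductProperty S T U) (h0 : ρ 0 ∈ S) {t t' u u' : A} (ht : ρ t ∈ T) (ht' : ρ t' ∈ T)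
    (hu : ρ u ∈ U) (hu' : ρ u' ∈ U) (he : t + u = t' + u') : t = t' ∧ u = u' := by
  have key : ρ 0 * (ρ 0)⁻¹ * (ρ t * (ρ t')⁻¹) * (ρ u * (ρ u')⁻¹) = 1 := by
    have e : ρ 0 * (ρ 0)⁻¹ * (ρ t * (ρ t')⁻¹) * (ρ u * (ρ u')⁻¹) = ρ ((t + u) - (t' + u')) := by
      simp only [inv_rho hρρ, hρρ]; congr 1; abel
    rw [e, sub_eq_zero.mpr he, rho_zero hρρ]
  obtain ⟨-, h1, h2⟩ := h _ h0 _ h0 _ ht _ ht' _ hu _ hu' key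
  exact ⟨hρ h1, hρ h2⟩

/-- (i) `T₁ + U₁` is direct. [folklore] -/
theorem domino_direct₁₁ (hρρ : ∀ a b, ρ a * ρ b = ρ (a + b)) (hττ : ∀ a b, τ a * τ b = ρ (c₀ + b - a))
    (hτ : Function.Injective τ) (h : TripleProductProperty S T U) (h0 : ρ 0 ∈ S) {t t' u u' : A}
    (ht : τ t ∈ T) (ht' : τ t' ∈ T) (hu : τ u ∈ U) (hu' : τ u' ∈ U) (he : t + u = t' + u') :
    t = t' ∧ u = u' := by
  have key : ρ 0 * (ρ 0)⁻¹ * (τ t' * (τ t)⁻¹) * (τ u' * (τ u)⁻¹) = 1 := by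
    have e : ρ 0 * (ρ 0)⁻¹ * (τ t' * (τ t)⁻¹) * (τ u' * (τ u)⁻¹) = ρ ((t + u) - (t' + u')) := by
      simp only [inv_rho hρρ, inv_tau hρρ hττ, hρρ, hττ]; congr 1; abel
    rw [e, sub_eq_zero.mpr he, rho_zero hρρ]
  obtain ⟨-, h1, h2⟩ := h _ h0 _ h0 _ ht' _ ht _ hu' _ hu key
  exact ⟨(hτ h1).symm, (hτ h2).symm⟩

/-- (i) `T₀ + U₁` is direct. [folklore] -/
theorem domino_direct₀₁ (hρρ : ∀ a b, ρ a * ρ b = ρ (a + b)) (hττ : ∀ a b, τ a * τ b = ρ (c₀ + b - a))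
    (hρ : Function.Injective ρ) (hτ : Function.Injective τ) (h : TripleProductProperty S T U) (h0 : ρ 0 ∈ S)
    {t t' u u' : A} (ht : ρ t ∈ T) (ht' : ρ t' ∈ T) (hu : τ u ∈ U) (hu' : τ u' ∈ U) (he : t + u = t' + u') :
    t = t' ∧ u = u' := by
  have key : ρ 0 * (ρ 0)⁻¹ * (ρ t * (ρ t')⁻¹) * (τ u' * (τ u)⁻¹) = 1 := by
    have e : ρ 0 * (ρ 0)⁻¹ * (ρ t * (ρ t')⁻¹) * (τ u' * (τ u)⁻¹) = ρ ((t + u) - (t' + u')) := by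
      simp only [inv_rho hρρ, inv_tau hρρ hττ, hρρ, hττ]; congr 1; abel
    rw [e, sub_eq_zero.mpr he, rho_zero hρρ]
  obtain ⟨-, h1, h2⟩ := h _ h0 _ h0 _ ht _ ht' _ hu' _ hu key
  exact ⟨hρ h1, (hτ h2).symm⟩

/-- (i) `T₁ + U₀` is direct. [folklore] -/
theorem domino_direct₁₀ (hρρ : ∀ a b, ρ a * ρ b = ρ (a + b)) (hττ : ∀ a b, τ a * τ b = ρ (c₀ + b - a))
    (hρ : Function.Injective ρ) (hτ : Function.Injective τ) (h : TripleProductProperty S T U) (h0 : ρ 0 ∈ S)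
    {t t' u u' : A} (ht : τ t ∈ T) (ht' : τ t' ∈ T) (hu : ρ u ∈ U) (hu' : ρ u' ∈ U) (he : t + u = t' + u') :
    t = t' ∧ u = u' := by
  have key : ρ 0 * (ρ 0)⁻¹ * (τ t' * (τ t)⁻¹) * (ρ u * (ρ u')⁻¹) = 1 := by
    have e : ρ 0 * (ρ 0)⁻¹ * (τ t' * (τ t)⁻¹) * (ρ u * (ρ u')⁻¹) = ρ ((t + u) - (t' + u')) := by
      simp only [inv_rho hρρ, inv_tau hρρ hττ, hρρ, hττ]; congr 1; abel
    rw [e, sub_eq_zero.mpr he, rho_zero hρρ]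
  obtain ⟨-, h1, h2⟩ := h _ h0 _ h0 _ ht' _ ht _ hu _ hu' key
  exact ⟨(hτ h1).symm, hρ h2⟩

/-- (ii) A mixed `T`-difference is never a mixed `U`-difference, nor one shifted by `c₀`:
`t₁ − t₀ ≠ u₁ − u₀` and `t₁ − t₀ ≠ u₁ − u₀ + c₀`. [folklore] -/
theorem domino_mixed_ne (hρρ : ∀ a b, ρ a * ρ b = ρ (a + b)) (hρτ : ∀ a b, ρ a * τ b = τ (b - a))
    (hτρ : ∀ a b, τ a * ρ b = τ (a + b)) (hττ : ∀ a b, τ a * τ b = ρ (c₀ + b - a)) (hne : ∀ a b, ρ a ≠ τ b)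
    (h : TripleProductProperty S T U) (h0 : ρ 0 ∈ S) {t₁ t₀ u₁ u₀ : A} (ht₁ : τ t₁ ∈ T) (ht₀ : ρ t₀ ∈ T)
    (hu₁ : τ u₁ ∈ U) (hu₀ : ρ u₀ ∈ U) : t₁ - t₀ ≠ u₁ - u₀ ∧ t₁ - t₀ ≠ u₁ - u₀ + c₀ := by
  constructor
  · intro he
    have key : ρ 0 * (ρ 0)⁻¹ * (τ t₁ * (ρ t₀)⁻¹) * (ρ u₀ * (τ u₁)⁻¹) = 1 := by
      have e : ρ 0 * (ρ 0)⁻¹ * (τ t₁ * (ρ t₀)⁻¹) * (ρ u₀ * (τ u₁)⁻¹) = ρ ((u₁ - u₀) - (t₁ - t₀)) := by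
        simp only [inv_rho hρρ, inv_tau hρρ hττ, hρρ, hρτ, hτρ, hττ]; congr 1; abel
      rw [e, sub_eq_zero.mpr he.symm, rho_zero hρρ]
    obtain ⟨-, h1, -⟩ := h _ h0 _ h0 _ ht₁ _ ht₀ _ hu₀ _ hu₁ key
    exact hne _ _ h1.symm
  · intro he
    have key : ρ 0 * (ρ 0)⁻¹ * (τ t₁ * (ρ t₀)⁻¹) * (τ u₁ * (ρ u₀)⁻¹) = 1 := by
      have e : ρ 0 * (ρ 0)⁻¹ * (τ t₁ * (ρ t₀)⁻¹) * (τ u₁ * (ρ u₀)⁻¹) = ρ ((u₁ - u₀ + c₀) - (t₁ - t₀)) := by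
        simp only [inv_rho hρρ, hρρ, hρτ, hτρ, hττ]; congr 1; abel
      rw [e, sub_eq_zero.mpr he.symm, rho_zero hρρ]
    obtain ⟨-, h1, -⟩ := h _ h0 _ h0 _ ht₁ _ ht₀ _ hu₁ _ hu₀ key
    exact hne _ _ h1.symm

/-- (iii) `b, b + c₀ ∉ (T₁ − T₀) + (U₀ − U₀)`. [folklore] -/
theorem domino_b_notin_T₀ (hρρ : ∀ a b, ρ a * ρ b = ρ (a + b)) (hρτ : ∀ a b, ρ a * τ b = τ (b - a))
    (hτρ : ∀ a b, τ a * ρ b = τ (a + b)) (hττ : ∀ a b, τ a * τ b = ρ (c₀ + b - a))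
    (hτ : Function.Injective τ) (hne : ∀ a b, ρ a ≠ τ b)
    (h : TripleProductProperty S T U) {b : A} (h0 : ρ 0 ∈ S) (hb : τ b ∈ S) {t₁ t₀ u u' : A} (ht₁ : τ t₁ ∈ T)
    (ht₀ : ρ t₀ ∈ T) (hu : ρ u ∈ U) (hu' : ρ u' ∈ U) :
    b ≠ t₁ - t₀ + (u - u') ∧ b + c₀ ≠ t₁ - t₀ + (u - u') := by
  have h2c : c₀ + c₀ = 0 := two_c0_eq_zero hρτ hτρ hττ hτ
  constructor
  · intro he
    have key : τ b * (ρ 0)⁻¹ * (ρ t₀ * (τ t₁)⁻¹) * (ρ u * (ρ u')⁻¹) = 1 := by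
      have e : τ b * (ρ 0)⁻¹ * (ρ t₀ * (τ t₁)⁻¹) * (ρ u * (ρ u')⁻¹) = ρ (t₁ - t₀ + (u - u') - b) := by
        simp only [inv_rho hρρ, inv_tau hρρ hττ, hρρ, hρτ, hτρ, hττ]; congr 1; abel
      rw [e, sub_eq_zero.mpr he.symm, rho_zero hρρ]
    obtain ⟨h1, -, -⟩ := h _ hb _ h0 _ ht₀ _ ht₁ _ hu _ hu' key
    exact hne _ _ h1.symm
  · intro he
    have he' : b - c₀ = t₁ - t₀ + (u - u') := by
      rw [← he, show b + c₀ = b - c₀ + (c₀ + c₀) by abel, h2c, add_zero]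
    have key : ρ 0 * (τ b)⁻¹ * (ρ t₀ * (τ t₁)⁻¹) * (ρ u * (ρ u')⁻¹) = 1 := by
      have e : ρ 0 * (τ b)⁻¹ * (ρ t₀ * (τ t₁)⁻¹) * (ρ u * (ρ u')⁻¹) = ρ (t₁ - t₀ + (u - u') - (b - c₀)) := by
        simp only [inv_rho hρρ, inv_tau hρρ hττ, hρρ, hρτ, hττ]; congr 1; abel
      rw [e, sub_eq_zero.mpr he'.symm, rho_zero hρρ]
    obtain ⟨h1, -, -⟩ := h _ h0 _ hb _ ht₀ _ ht₁ _ hu _ hu' key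
    exact hne _ _ h1

/-- (iii) `b, b + c₀ ∉ (T₁ − T₀) + (U₁ − U₁)`. [folklore] -/
theorem domino_b_notin_T₁ (hρρ : ∀ a b, ρ a * ρ b = ρ (a + b)) (hρτ : ∀ a b, ρ a * τ b = τ (b - a))
    (hτρ : ∀ a b, τ a * ρ b = τ (a + b)) (hττ : ∀ a b, τ a * τ b = ρ (c₀ + b - a))
    (hτ : Function.Injective τ) (hne : ∀ a b, ρ a ≠ τ b)
    (h : TripleProductProperty S T U) {b : A} (h0 : ρ 0 ∈ S) (hb : τ b ∈ S) {t₁ t₀ u u' : A} (ht₁ : τ t₁ ∈ T)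
    (ht₀ : ρ t₀ ∈ T) (hu : τ u ∈ U) (hu' : τ u' ∈ U) :
    b ≠ t₁ - t₀ + (u - u') ∧ b + c₀ ≠ t₁ - t₀ + (u - u') := by
  have h2c : c₀ + c₀ = 0 := two_c0_eq_zero hρτ hτρ hττ hτ
  constructor
  · intro he
    have key : τ b * (ρ 0)⁻¹ * (ρ t₀ * (τ t₁)⁻¹) * (τ u' * (τ u)⁻¹) = 1 := by
      have e : τ b * (ρ 0)⁻¹ * (ρ t₀ * (τ t₁)⁻¹) * (τ u' * (τ u)⁻¹) = ρ (t₁ - t₀ + (u - u') - b) := by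
        simp only [inv_rho hρρ, inv_tau hρρ hττ, hρρ, hρτ, hτρ, hττ]; congr 1; abel
      rw [e, sub_eq_zero.mpr he.symm, rho_zero hρρ]
    obtain ⟨h1, -, -⟩ := h _ hb _ h0 _ ht₀ _ ht₁ _ hu' _ hu key
    exact hne _ _ h1.symm
  · intro he
    have he' : b - c₀ = t₁ - t₀ + (u - u') := by
      rw [← he, show b + c₀ = b - c₀ + (c₀ + c₀) by abel, h2c, add_zero]
    have key : ρ 0 * (τ b)⁻¹ * (ρ t₀ * (τ t₁)⁻¹) * (τ u' * (τ u)⁻¹) = 1 := by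
      have e : ρ 0 * (τ b)⁻¹ * (ρ t₀ * (τ t₁)⁻¹) * (τ u' * (τ u)⁻¹) = ρ (t₁ - t₀ + (u - u') - (b - c₀)) := by
        simp only [inv_tau hρρ hττ, hρρ, hρτ, hττ]; congr 1; abel
      rw [e, sub_eq_zero.mpr he'.symm, rho_zero hρρ]
    obtain ⟨h1, -, -⟩ := h _ h0 _ hb _ ht₀ _ ht₁ _ hu' _ hu key
    exact hne _ _ h1

/-- (iii) `b, b + c₀ ∉ (U₁ − U₀) + (T₀ − T₀)`. [folklore] -/
theorem domino_b_notin_U₀ (hρρ : ∀ a b, ρ a * ρ b = ρ (a + b)) (hρτ : ∀ a b, ρ a * τ b = τ (b - a))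
    (hτρ : ∀ a b, τ a * ρ b = τ (a + b)) (hττ : ∀ a b, τ a * τ b = ρ (c₀ + b - a))
    (hτ : Function.Injective τ) (hne : ∀ a b, ρ a ≠ τ b)
    (h : TripleProductProperty S T U) {b : A} (h0 : ρ 0 ∈ S) (hb : τ b ∈ S) {u₁ u₀ t t' : A} (hu₁ : τ u₁ ∈ U)
    (hu₀ : ρ u₀ ∈ U) (ht : ρ t ∈ T) (ht' : ρ t' ∈ T) :
    b ≠ u₁ - u₀ + (t - t') ∧ b + c₀ ≠ u₁ - u₀ + (t - t') := by
  have h2c : c₀ + c₀ = 0 := two_c0_eq_zero hρτ hτρ hττ hτ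
  constructor
  · intro he
    have key : τ b * (ρ 0)⁻¹ * (ρ t' * (ρ t)⁻¹) * (ρ u₀ * (τ u₁)⁻¹) = 1 := by
      have e : τ b * (ρ 0)⁻¹ * (ρ t' * (ρ t)⁻¹) * (ρ u₀ * (τ u₁)⁻¹) = ρ (u₁ - u₀ + (t - t') - b) := by
        simp only [inv_rho hρρ, inv_tau hρρ hττ, hρρ, hρτ, hτρ, hττ]; congr 1; abel
      rw [e, sub_eq_zero.mpr he.symm, rho_zero hρρ]
    obtain ⟨h1, -, -⟩ := h _ hb _ h0 _ ht' _ ht _ hu₀ _ hu₁ key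
    exact hne _ _ h1.symm
  · intro he
    have he' : b - c₀ = u₁ - u₀ + (t - t') := by
      rw [← he, show b + c₀ = b - c₀ + (c₀ + c₀) by abel, h2c, add_zero]
    have key : ρ 0 * (τ b)⁻¹ * (ρ t' * (ρ t)⁻¹) * (ρ u₀ * (τ u₁)⁻¹) = 1 := by
      have e : ρ 0 * (τ b)⁻¹ * (ρ t' * (ρ t)⁻¹) * (ρ u₀ * (τ u₁)⁻¹) = ρ (u₁ - u₀ + (t - t') - (b - c₀)) := by
        simp only [inv_rho hρρ, inv_tau hρρ hττ, hρρ, hρτ, hτρ, hττ]; congr 1; abel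
      rw [e, sub_eq_zero.mpr he'.symm, rho_zero hρρ]
    obtain ⟨h1, -, -⟩ := h _ h0 _ hb _ ht' _ ht _ hu₀ _ hu₁ key
    exact hne _ _ h1

/-- (iii) `b, b + c₀ ∉ (U₁ − U₀) + (T₁ − T₁)`. [folklore] -/
theorem domino_b_notin_U₁ (hρρ : ∀ a b, ρ a * ρ b = ρ (a + b)) (hρτ : ∀ a b, ρ a * τ b = τ (b - a))
    (hτρ : ∀ a b, τ a * ρ b = τ (a + b)) (hττ : ∀ a b, τ a * τ b = ρ (c₀ + b - a))
    (hτ : Function.Injective τ) (hne : ∀ a b, ρ a ≠ τ b)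
    (h : TripleProductProperty S T U) {b : A} (h0 : ρ 0 ∈ S) (hb : τ b ∈ S) {u₁ u₀ t t' : A} (hu₁ : τ u₁ ∈ U)
    (hu₀ : ρ u₀ ∈ U) (ht : τ t ∈ T) (ht' : τ t' ∈ T) :
    b ≠ u₁ - u₀ + (t - t') ∧ b + c₀ ≠ u₁ - u₀ + (t - t') := by
  have h2c : c₀ + c₀ = 0 := two_c0_eq_zero hρτ hτρ hττ hτ
  constructor
  · intro he
    have key : τ b * (ρ 0)⁻¹ * (τ t * (τ t')⁻¹) * (ρ u₀ * (τ u₁)⁻¹) = 1 := by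
      have e : τ b * (ρ 0)⁻¹ * (τ t * (τ t')⁻¹) * (ρ u₀ * (τ u₁)⁻¹) = ρ (u₁ - u₀ + (t - t') - b) := by
        simp only [inv_rho hρρ, inv_tau hρρ hττ, hρτ, hτρ, hττ]; congr 1; abel
      rw [e, sub_eq_zero.mpr he.symm, rho_zero hρρ]
    obtain ⟨h1, -, -⟩ := h _ hb _ h0 _ ht _ ht' _ hu₀ _ hu₁ key
    exact hne _ _ h1.symm
  · intro he
    have he' : b - c₀ = u₁ - u₀ + (t - t') := by
      rw [← he, show b + c₀ = b - c₀ + (c₀ + c₀) by abel, h2c, add_zero]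
    have key : ρ 0 * (τ b)⁻¹ * (τ t * (τ t')⁻¹) * (ρ u₀ * (τ u₁)⁻¹) = 1 := by
      have e : ρ 0 * (τ b)⁻¹ * (τ t * (τ t')⁻¹) * (ρ u₀ * (τ u₁)⁻¹) = ρ (u₁ - u₀ + (t - t') - (b - c₀)) := by
        simp only [inv_tau hρρ hττ, hρτ, hτρ, hττ]; congr 1; abel
      rw [e, sub_eq_zero.mpr he'.symm, rho_zero hρρ]
    obtain ⟨h1, -, -⟩ := h _ h0 _ hb _ ht _ ht' _ hu₀ _ hu₁ key
    exact hne _ _ h1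

end DihedralLike

end Summit.MatrixMultiplication.OmegaCensus
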